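import Literature.AlgebraicGeometry.HodgeTheory.SemiregularityMap
import Summits.HodgeConjecture.HodgeConjecture.Theorems.SemiregularSeedsOnAnchors.Negative.SemiregularityCarrier

/-!
# C4 · the Buchweitz–Flenner SANDWICH door of a lettered monad (hsemireg-c4-1 g19, v1.0, 2026-08-30)

pub-hsemireg row C4 (simplicity ∕ μ-(semi)stability of the monad bundle `E` for the product polarisation), generation 19.
Memo of record: `C4-BFSANDWICH-c4-1-g19.md` (same directory); engine `code/g19/bfdoor.py`; census `data/g19/bfdoor/census.txt`.
This file is the FIRST typed bridge from the C4 column (non-simplicity certificates: rank-one endomorphisms `θ = ψ ∘ g ∘ φ` of `E`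
through two letters, c4-1 g0 (NS) ∕ g18 §2.4) to a SEED DOOR — the Buchweitz–Flenner sheaf door (`IsSemiregular`,
`IsISemiregular` on the tree's σ-carrier `AtiyahTraceAlgebra`, BF Def. 4.1; used by `Summit.Ventures.HSemireg.HasBFSheafSeedOn`).

WHAT IS KERNEL-CHECKED (all `sorry`-free; `𝕜` any commutative ring unless a field is named):
§1 `SandwichDatum A B M P` — the two-object slice of BF's algebra: `A` = the σ-carrier of `E`, `B` = the σ-carrier of a second
   object `L′`, `M i j = Extⁱ(E, L′ ⊗ Λʲ)`, `P = Hom(L′, E)`, with `post ψ m = (ψ ⊗ 1) ∘ m ∈ A.Ext i j`, `pre ψ m = m ∘ ψ ∈ B.Ext i j`,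
   `atiyahPush q b = At^q(L′) ∘ b`, `toCoh` = the identity of `Hⁱ(X, Λʲ)` seen from the two carriers, and three axioms, each a
   one-line identity of Yoneda compositions: `post_atiyah` ∕ `pre_atiyah` = NATURALITY of the Atiyah class (for the degree-2 class
   `b`, resp. the degree-0 map `ψ`; no sign in either composition convention because `deg b = 2` is even), `trace_post` = the
   COMMUTATIVITY of Illusie's trace `Tr_E((ψ ⊗ 1) ∘ m) = Tr_{L′}(m ∘ ψ)`.
§2 LEMMA K (TRANSFER FORMULA) `semiregularityComponent_post`: `σ^E_q((ψ ⊗ 1) ∘ b) = σ^{L′}_q(b ∘ ψ)` for every `q`; hence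
   (`…_post_eq_zero`, `semiregularityMap_post_eq_zero`) every SANDWICH CLASS `x = (ψ ⊗ 1) ∘ b` with `b ∘ ψ = 0` lies in `ker σ_E`
   (all components), so (`post_eq_zero_of_isSemiregular`, `…_of_isISemiregular`) a BF-(I-)semiregular `E` has NO non-zero sandwich
   class, and (`not_isSemiregular_of_sandwich`, `not_isISemiregular_of_sandwich`) one non-zero sandwich class refutes
   (I-)semiregularity for EVERY index set `I`; `span_sandwich_le_ker`.
§3 the MONAD origin of `b ∘ ψ = 0` (`pre_comp_eq_zero`, `monad_sandwich_in_ker`): `b = y ∘ φ` with `φ : E → L`, `y ∈ Ext²(L, L′)`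
   and `φ ∘ ψ = 0` — for a display `A —i→ N —q→ C`, `E = ker q ∕ im i`, this is the case `ψ = ψ_Z : N_Z → E` (Z a C-target-free
   N-class, so `q|_{N_Z} = 0`), `φ = φ_{Z′} : E → N_{Z′}` (Z′ an A-source-free class, so `pr_{Z′} ∘ i = 0`), `Z ≠ Z′`
   (`φ_{Z′} ∘ ψ_Z = pr_{Z′}|_{N_Z} = 0`): an ADMISSIBLE pair; the C4 endomorphisms `θ` are the sandwiches with `y = ω ∪ g`.
§4 numbers: the tree's forced-kernel bound `Negative.finrank_ext_le_of_isSemiregular` specialised to an abelian 8-fold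
   (`finrank_ext_le_8008`: `Σ_{q ≤ 6} C(8,q)·C(8,q+2) = 8008 = C(16,6)`), and the single-component door of record for `n = 4`
   (`finrank_ext_le_of_isKSemiregular_three`: `σ₃ : Ext² → H⁵(Ω³)`, `dim = 56·56 = 3136`, c4-1 g0 (V4)); calibration
   `isSemiregular_of_trace_injective` (letters: simple semi-homogeneous bundles have `Ext²(L,L) = H²(𝒪)·id`, Mukai, so `σ₀ = Tr`
   is injective and every LETTER is semiregular — the monad must not spoil it).
§5 the design-level predicate spec (`HSemireg.C4BFSandwich.Design`): C-target-free ∕ A-source-free classes, admissible and HOT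
   pairs, the SANDWICH-FREE design rule (R5) and the census digits of the three program-M designs of record (M1 `a24-dblC3`,
   M3 `s2-a16-dblC`, SYM `a24-dblC3-sym`) as records with `decide`d consistency checks.
NOT CHECKED HERE (pen, memo §1–§2): that the geometric Ext-groups of a monad on `X = S⁴` furnish a `SandwichDatum` (Illusie Ch. V;
BF §3–§4; Huybrechts–Lehn 10.1), the §9 `h⁰`-law reading of "C-target-free ∕ A-source-free", the calibration theorems SPLIT-BF and
UNIPOTENT of the memo.  HONEST: a sandwich class is an OBLIGATION on the maps of a posited display (BF-semiregular ⇒ every sandwich map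
`Ext²(N_{Z′}, N_Z) → Ext²(E, E)` vanishes), not a kill of a design; designs ≠ complexes ≠ sheaves ≠ a SEED; nothing in this file is a
step toward HC ∕ HC_CM ∕ HC_AV ∕ №4 ∕ 26512 ∕ 18881 ∕ H2.  No `instance`, no `notation`, no `sorry`, no `native_decide`, no banned option.

References: [BuchweitzFlenner2003] §3 (Atiyah class, functoriality), §4 (trace, algebra `A`, Def. 4.1), §5 (I-semiregular);
[Illusie1971CotangentI] Ch. V (trace, additivity ∕ commutativity); [HuybrechtsLehn2010] §10.1 (trace map, Atiyah class,
`Tr(At) = c₁`); [Mukai1978SemiHomogeneous] §4–§6 (simple semi-homogeneous bundles, `End E ≅ ⊕_σ P_σ`); [Markman2025SecantWeil]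
Lemma 8.3.4, Rem. 8.3.5 (p. 47–48 of arXiv:2502.03415v3: `σ ∘ ob_E = (· ⌟ ch(E))`, the `ext² ≤ dim HT²` growth heuristic p. 44).
-/

set_option linter.unusedVariables false

universe u v w w'

namespace HSemireg.C4BFSandwich

open Literature.AlgebraicGeometry.HodgeTheory

/-! ### §1 The two-object slice of the Buchweitz–Flenner algebra -/

/-- **Sandwich datum.** The slice of BF's Yoneda algebra seen by one pair of objects `(E, L′)` on the same space `X`:
`A` = σ-carrier of `E` (`A.Ext i j = Extⁱ(E, E ⊗ Λʲ)`, `A.Coh i j = Hⁱ(X, Λʲ)`, `Tr_E`, `At(E)`), `B` = σ-carrier of `L′`,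
`M i j = Extⁱ_X(E, L′ ⊗ Λʲ)`, `P = Hom_X(L′, E)`; `post i j ψ m = (ψ ⊗ 1_{Λʲ}) ∘ m`, `pre i j ψ m = m ∘ ψ`,
`atiyahPush q b = At^q(L′) ∘ b` (`b ∈ Ext²(E, L′)`), `toCoh i j` = the identification of `Hⁱ(X, Λʲ)` in the two carriers.
Axioms: `post_atiyah` — `((ψ ⊗ 1) ∘ b) · At^q(E) = (ψ ⊗ 1) ∘ (At^q(L′) ∘ b)` (naturality of the Atiyah class w.r.t. `b`, or w.r.t.
`ψ` in the other composition convention; `deg b = 2` even ⇒ no sign); `pre_atiyah` — `(At^q(L′) ∘ b) ∘ ψ = (b ∘ ψ) · At^q(L′)`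
(same naturality on the `L′` side); `trace_post` — `Tr_E((ψ ⊗ 1) ∘ m) = Tr_{L′}(m ∘ ψ)` (commutativity of Illusie's trace).
A PREDICATE-CARRIER: nothing asserts that a given sheaf furnishes one (pen, memo §1).
[cite: BuchweitzFlenner2003, §3 and §4] [cite: Illusie1971CotangentI, Ch. V] [cite: HuybrechtsLehn2010, §10.1] -/
structure SandwichDatum {𝕜 : Type u} [CommRing 𝕜] (A B : AtiyahTraceAlgebra.{u, v} 𝕜)
    (M : ℕ → ℕ → Type w) [∀ i j, AddCommGroup (M i j)] [∀ i j, Module 𝕜 (M i j)]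
    (P : Type w') [AddCommGroup P] [Module 𝕜 P] where
  /-- `(ψ, m) ↦ (ψ ⊗ 1) ∘ m : Hom(L′, E) × Extⁱ(E, L′ ⊗ Λʲ) → Extⁱ(E, E ⊗ Λʲ)`. [cite: BuchweitzFlenner2003, §4] -/
  post (i j : ℕ) : P →ₗ[𝕜] M i j →ₗ[𝕜] A.Ext i j
  /-- `(ψ, m) ↦ m ∘ ψ : Hom(L′, E) × Extⁱ(E, L′ ⊗ Λʲ) → Extⁱ(L′, L′ ⊗ Λʲ)`. [cite: BuchweitzFlenner2003, §4] -/
  pre (i j : ℕ) : P →ₗ[𝕜] M i j →ₗ[𝕜] B.Ext i j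
  /-- `b ↦ At^q(L′) ∘ b : Ext²(E, L′) → Ext^{q+2}(E, L′ ⊗ Λ^q)`. [cite: BuchweitzFlenner2003, §3] -/
  atiyahPush (q : ℕ) : M 2 0 →ₗ[𝕜] M (q + 2) q
  /-- `Hⁱ(X, Λʲ)` of the `L′`-carrier → `Hⁱ(X, Λʲ)` of the `E`-carrier (geometrically the identity). [cite: BuchweitzFlenner2003, §4] -/
  toCoh (i j : ℕ) : B.Coh i j →ₗ[𝕜] A.Coh i j
  /-- Naturality of the Atiyah class across `b ∈ Ext²(E, L′)`: `((ψ⊗1)∘b)·At^q(E) = (ψ⊗1)∘(At^q(L′)∘b)`. [cite: BuchweitzFlenner2003, §3] -/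
  post_atiyah (ψ : P) (q : ℕ) (b : M 2 0) :
    A.mul (Nat.add_comm 2 q) (Nat.zero_add q) (post 2 0 ψ b) (A.atiyahPow q) = post (q + 2) q ψ (atiyahPush q b)
  /-- Naturality of the Atiyah class on the `L′` side: `(At^q(L′)∘b)∘ψ = (b∘ψ)·At^q(L′)`. [cite: BuchweitzFlenner2003, §3] -/
  pre_atiyah (ψ : P) (q : ℕ) (b : M 2 0) :
    pre (q + 2) q ψ (atiyahPush q b) = B.mul (Nat.add_comm 2 q) (Nat.zero_add q) (pre 2 0 ψ b) (B.atiyahPow q)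
  /-- Commutativity of the trace: `Tr_E((ψ ⊗ 1) ∘ m) = Tr_{L′}(m ∘ ψ)`. [cite: Illusie1971CotangentI, Ch. V] [cite: HuybrechtsLehn2010, §10.1] -/
  trace_post (i j : ℕ) (ψ : P) (m : M i j) :
    A.trace i j (post i j ψ m) = toCoh i j (B.trace i j (pre i j ψ m))

namespace SandwichDatum

variable {𝕜 : Type u} [CommRing 𝕜] {A B : AtiyahTraceAlgebra.{u, v} 𝕜}
  {M : ℕ → ℕ → Type w} [∀ i j, AddCommGroup (M i j)] [∀ i j, Module 𝕜 (M i j)]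
  {P : Type w'} [AddCommGroup P] [Module 𝕜 P] (D : SandwichDatum A B M P)

/-! ### §2 LEMMA K — the transfer formula and the sandwich classes in `ker σ_E` -/

/-- **LEMMA K (transfer formula).** For `ψ ∈ Hom(L′, E)` and `b ∈ Ext²(E, L′)`:
`σ^E_q((ψ ⊗ 1) ∘ b) = σ^{L′}_q(b ∘ ψ)` in `H^{q+2}(X, Λ^q)`, for every form degree `q`.
Proof: `Tr_E(((ψ⊗1)∘b)·At^q_E) = Tr_E((ψ⊗1)∘(At^q_{L′}∘b)) = Tr_{L′}((At^q_{L′}∘b)∘ψ) = Tr_{L′}((b∘ψ)·At^q_{L′})`.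
[cite: BuchweitzFlenner2003, Def. 4.1 and §3] [cite: Illusie1971CotangentI, Ch. V] -/
theorem semiregularityComponent_post (ψ : P) (b : M 2 0) (q : ℕ) :
    A.semiregularityComponent q (D.post 2 0 ψ b) =
      D.toCoh (q + 2) q (B.semiregularityComponent q (D.pre 2 0 ψ b)) := by
  rw [AtiyahTraceAlgebra.semiregularityComponent_apply, AtiyahTraceAlgebra.semiregularityComponent_apply,
    D.post_atiyah, D.trace_post, D.pre_atiyah, LinearMap.map_smul]

/-- **Sandwich classes die under every component of `σ_E`.** If `b ∘ ψ = 0` in `Ext²(L′, L′)` then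
`σ^E_q((ψ ⊗ 1) ∘ b) = 0` for all `q`. [cite: BuchweitzFlenner2003, Def. 4.1] -/
theorem semiregularityComponent_post_eq_zero {ψ : P} {b : M 2 0} (h : D.pre 2 0 ψ b = 0) (q : ℕ) :
    A.semiregularityComponent q (D.post 2 0 ψ b) = 0 := by
  rw [D.semiregularityComponent_post, h, map_zero, map_zero]

/-- The whole semiregularity map kills a sandwich class. [cite: BuchweitzFlenner2003, Def. 4.1] -/
theorem semiregularityMap_post_eq_zero {ψ : P} {b : M 2 0} (h : D.pre 2 0 ψ b = 0) :
    A.semiregularityMap (D.post 2 0 ψ b) = 0 := by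
  funext q
  rw [AtiyahTraceAlgebra.semiregularityMap_apply, D.semiregularityComponent_post_eq_zero h q]
  rfl

/-- **OBLIGATION (sandwich-vanishing).** In a BF-semiregular `E` every sandwich class is zero:
`b ∘ ψ = 0 ⇒ (ψ ⊗ 1) ∘ b = 0`. [cite: BuchweitzFlenner2003, §1 and §7 (semiregular)] -/
theorem post_eq_zero_of_isSemiregular (hA : A.IsSemiregular) {ψ : P} {b : M 2 0} (h : D.pre 2 0 ψ b = 0) :
    D.post 2 0 ψ b = 0 :=
  (AtiyahTraceAlgebra.isSemiregular_iff A).1 hA _ (D.semiregularityComponent_post_eq_zero h)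

/-- The same for `I`-semiregularity, ANY set `I` of form degrees (the door of record asks `I`-semiregularity with the seed
degree in `I`). [cite: BuchweitzFlenner2003, §5 (I-semiregular)] -/
theorem post_eq_zero_of_isISemiregular (I : Set ℕ) (hA : A.IsISemiregular I) {ψ : P} {b : M 2 0}
    (h : D.pre 2 0 ψ b = 0) : D.post 2 0 ψ b = 0 :=
  hA _ fun k _ => D.semiregularityComponent_post_eq_zero h k

/-- **Would-be kill.** One sandwich class `(ψ ⊗ 1) ∘ b ≠ 0` with `b ∘ ψ = 0` refutes BF-semiregularity of `E`.
[cite: BuchweitzFlenner2003, Def. 4.1] -/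
theorem not_isSemiregular_of_sandwich {ψ : P} {b : M 2 0} (h : D.pre 2 0 ψ b = 0) (hne : D.post 2 0 ψ b ≠ 0) :
    ¬ A.IsSemiregular :=
  fun hA => hne (D.post_eq_zero_of_isSemiregular hA h)

/-- … and refutes `I`-semiregularity for every `I`. [cite: BuchweitzFlenner2003, §5 (I-semiregular)] -/
theorem not_isISemiregular_of_sandwich (I : Set ℕ) {ψ : P} {b : M 2 0} (h : D.pre 2 0 ψ b = 0)
    (hne : D.post 2 0 ψ b ≠ 0) : ¬ A.IsISemiregular I :=
  fun hA => hne (D.post_eq_zero_of_isISemiregular I hA h)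

/-- The set of sandwich classes of the pair `(E, L′)`: all `(ψ ⊗ 1) ∘ b` with `b ∘ ψ = 0`. [cite: BuchweitzFlenner2003, §4] -/
def sandwichSet : Set (A.Ext 2 0) :=
  {x | ∃ (ψ : P) (b : M 2 0), D.pre 2 0 ψ b = 0 ∧ D.post 2 0 ψ b = x}

/-- **The sandwich span lies in `ker σ_E`.** [cite: BuchweitzFlenner2003, Def. 4.1] -/
theorem span_sandwich_le_ker : Submodule.span 𝕜 D.sandwichSet ≤ LinearMap.ker A.semiregularityMap := by
  rw [Submodule.span_le]
  rintro x ⟨ψ, b, h, rfl⟩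
  exact (LinearMap.mem_ker).2 (D.semiregularityMap_post_eq_zero h)

/-! ### §3 The monad origin of `b ∘ ψ = 0`: admissible pairs of a display -/

/-- **Admissible factorisation.** If `b = y ∘ φ` (`φ ∈ Hom(E, L)`, `y ∈ Ext²(L, L′)`) and composition is associative
(`(y ∘ φ) ∘ ψ = y ∘ (φ ∘ ψ)`, the hypothesis `hassoc` on the three bilinear maps `comp : (y, φ) ↦ y ∘ φ`, `circ : (φ, ψ) ↦ φ ∘ ψ`,
`star : (y, r) ↦ y ∘ r`), then `φ ∘ ψ = 0` forces `b ∘ ψ = 0`. For a display `A —i→ N —q→ C` this is the ADMISSIBLE PAIR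
`ψ = ψ_Z`, `φ = φ_{Z′}`, `Z ≠ Z′` (`φ_{Z′} ∘ ψ_Z = pr_{Z′}|_{N_Z} = 0`). [cite: BuchweitzFlenner2003, §4] -/
theorem pre_comp_eq_zero {Q : Type*} [AddCommGroup Q] [Module 𝕜 Q] {N : Type*} [AddCommGroup N] [Module 𝕜 N]
    {R : Type*} [AddCommGroup R] [Module 𝕜 R] (comp : N →ₗ[𝕜] Q →ₗ[𝕜] M 2 0) (circ : Q →ₗ[𝕜] P →ₗ[𝕜] R)
    (star : N →ₗ[𝕜] R →ₗ[𝕜] B.Ext 2 0) (hassoc : ∀ (y : N) (φ : Q) (ψ : P), D.pre 2 0 ψ (comp y φ) = star y (circ φ ψ))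
    {φ : Q} {ψ : P} (hφψ : circ φ ψ = 0) (y : N) : D.pre 2 0 ψ (comp y φ) = 0 := by
  rw [hassoc, hφψ, map_zero]

/-- **Monad sandwich in `ker σ`.** With the data of `pre_comp_eq_zero`: every `x = ψ ∘ y ∘ φ`, `y ∈ Ext²(N_{Z′}, N_Z)`, of an
admissible pair is killed by every `σ_q`; in particular the C4 non-simplicity endomorphisms `θ = ψ ∘ g ∘ φ` give
`σ_E(ω ∪ θ) = 0` for all `ω ∈ H²(X, 𝒪_X)` (take `y = ω ∪ g`). [cite: BuchweitzFlenner2003, Def. 4.1] -/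
theorem monad_sandwich_in_ker {Q : Type*} [AddCommGroup Q] [Module 𝕜 Q] {N : Type*} [AddCommGroup N] [Module 𝕜 N]
    {R : Type*} [AddCommGroup R] [Module 𝕜 R] (comp : N →ₗ[𝕜] Q →ₗ[𝕜] M 2 0) (circ : Q →ₗ[𝕜] P →ₗ[𝕜] R)
    (star : N →ₗ[𝕜] R →ₗ[𝕜] B.Ext 2 0) (hassoc : ∀ (y : N) (φ : Q) (ψ : P), D.pre 2 0 ψ (comp y φ) = star y (circ φ ψ))
    {φ : Q} {ψ : P} (hφψ : circ φ ψ = 0) (y : N) (q : ℕ) :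
    A.semiregularityComponent q (D.post 2 0 ψ (comp y φ)) = 0 :=
  D.semiregularityComponent_post_eq_zero (D.pre_comp_eq_zero comp circ star hassoc hφψ y) q

/-- **Monad obligation.** A BF-semiregular `E` has ZERO sandwich map `y ↦ ψ_Z ∘ y ∘ φ_{Z′}` on every admissible pair.
[cite: BuchweitzFlenner2003, §1 and §7] -/
theorem monad_post_eq_zero_of_isSemiregular {Q : Type*} [AddCommGroup Q] [Module 𝕜 Q] {N : Type*} [AddCommGroup N]
    [Module 𝕜 N] {R : Type*} [AddCommGroup R] [Module 𝕜 R] (comp : N →ₗ[𝕜] Q →ₗ[𝕜] M 2 0)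
    (circ : Q →ₗ[𝕜] P →ₗ[𝕜] R) (star : N →ₗ[𝕜] R →ₗ[𝕜] B.Ext 2 0)
    (hassoc : ∀ (y : N) (φ : Q) (ψ : P), D.pre 2 0 ψ (comp y φ) = star y (circ φ ψ))
    (hA : A.IsSemiregular) {φ : Q} {ψ : P} (hφψ : circ φ ψ = 0) (y : N) : D.post 2 0 ψ (comp y φ) = 0 :=
  D.post_eq_zero_of_isSemiregular hA (D.pre_comp_eq_zero comp circ star hassoc hφψ y)

end SandwichDatum

/-! ### §4 Numbers on an abelian 8-fold and the letter calibration -/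

section Numbers

variable {K : Type u} [Field K] (A : AtiyahTraceAlgebra.{u, v} K)

/-- `Σ_{q=0}^{6} C(8,q)·C(8,q+2) = 8008 = C(16,6)`: the dimension of the full BF target `⊕_q H^{q+2}(X, Ω^q)` on an abelian
8-fold (`h^{q,p} = C(8,p)·C(8,q)`). [cite: BuchweitzFlenner2003, Def. 4.1] -/
theorem target_dim_abelian_eightfold :
    (∑ k ∈ Finset.range 7, Nat.choose 8 k * Nat.choose 8 (k + 2)) = 8008 ∧ Nat.choose 16 6 = 8008 := by
  constructor <;> decide

/-- **The full BF door on an abelian 8-fold needs `ext²(E,E) ≤ 8008`.** Specialisation of the tree's forced-kernel bound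
`Negative.finrank_ext_le_of_isSemiregular` (components `q ≥ 7` vanish since `H^{q+2} = 0`). Markman's criterion route (his
Lemma 8.3.4: `σ ∘ ob_E = (· ⌟ ch(E))`, `ob_E` onto) needs the far stronger `ext²(E,E) ≤ dim HT²(X) = 120`. [folklore]
[cite: Markman2025SecantWeil, Lemma 8.3.4 and Rem. 8.3.5] -/
theorem finrank_ext_le_8008 (hS : ∀ k ∉ Finset.range 7, A.semiregularityComponent k = 0)
    [∀ k : (Finset.range 7 : Finset ℕ), FiniteDimensional K (A.Coh (k + 2) k)]
    (hdim : ∀ k < 7, Module.finrank K (A.Coh (k + 2) k) = Nat.choose 8 k * Nat.choose 8 (k + 2))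
    (h : A.IsSemiregular) : Module.finrank K (A.Ext 2 0) ≤ 8008 := by
  have h1 := Summit.HodgeConjecture.HodgeConjecture.Theorems.SemiregularSeedsOnAnchors.Negative.finrank_ext_le_of_isSemiregular
    A (Finset.range 7) hS h
  have h2 : (∑ k ∈ Finset.range 7, Module.finrank K (A.Coh (k + 2) k)) =
      ∑ k ∈ Finset.range 7, Nat.choose 8 k * Nat.choose 8 (k + 2) :=
    Finset.sum_congr rfl fun k hk => hdim k (Finset.mem_range.1 hk)
  rw [h2, target_dim_abelian_eightfold.1] at h1
  exact h1

/-- **The single-component door of record for `n = 4`** (`HasBFSheafSeedOn … I` with `I = {4}` asks `σ₃ : Ext²(E,E) → H⁵(X, Ω³)`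
injective): `ext²(E,E) ≤ h^{3,5} = 56·56 = 3136` (c4-1 g0 (V4)). [folklore] [cite: BuchweitzFlenner2003, §5 (I-semiregular)] -/
theorem finrank_ext_le_of_isKSemiregular_three [FiniteDimensional K (A.Coh 5 3)]
    (hdim : Module.finrank K (A.Coh 5 3) = 3136) (h : A.IsKSemiregular 3) :
    Module.finrank K (A.Ext 2 0) ≤ 3136 := by
  rw [← hdim]
  exact LinearMap.finrank_le_finrank_of_injective h

/-- `56·56 = 3136 = C(8,5)·C(8,3)`. [cite: BuchweitzFlenner2003, §5] -/
theorem h35_abelian_eightfold : Nat.choose 8 5 * Nat.choose 8 3 = 3136 := by decide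

/-- **Letter calibration.** If `σ₀ = Tr : Ext²(F,F) → H²(X,𝒪)` is injective then `F` is semiregular. For a simple
semi-homogeneous bundle (every LETTER of program M) `Ext²(F,F) = H²(𝒪_X)·id_F` (Mukai: `End F ≅ ⊕_{σ ∈ Σ(F)} P_σ`, `H^*(P_σ) = 0`
for `σ ≠ 0`) and `Tr(ω·id) = r·ω`, so letters are semiregular in characteristic `0`: the sandwich classes are created by the GLUING.
[cite: BuchweitzFlenner2003, §1 (σ₀, Artamkin–Mukai)] [cite: Mukai1978SemiHomogeneous, §4–§6] -/
theorem isSemiregular_of_trace_injective {𝕜 : Type u} [CommRing 𝕜] (F : AtiyahTraceAlgebra.{u, v} 𝕜)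
    (h : Function.Injective (F.trace 2 0)) : F.IsSemiregular := by
  rw [AtiyahTraceAlgebra.isSemiregular_iff]
  intro x hx
  have h0 := hx 0
  rw [AtiyahTraceAlgebra.semiregularityComponent_zero_apply] at h0
  exact h (by rw [h0, map_zero])

end Numbers

/-! ### §5 Design-level predicate spec and the census of record (oracle digits) -/

namespace Design

/-- A lettered display design seen by the sandwich door: N-classes `ι`, A-classes `α`, C-classes `γ`, multiplicities `m`,
and the pair oracle `h0AN a Z = h⁰(L_a^∨ ⊗ L_Z)`, `h0NC Z c = h⁰(L_Z^∨ ⊗ L_c)`, `h2NN Z′ Z = h²(L_{Z′}^∨ ⊗ L_Z) = ext²(L_{Z′}, L_Z)`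
(semihom-1 §9 table). [cite: Mukai1978SemiHomogeneous, §6] -/
structure PairOracle (ι α γ : Type) where
  /-- multiplicity of an N-class -/
  m : ι → ℕ
  /-- `h⁰(a → Z)` -/
  h0AN : α → ι → ℕ
  /-- `h⁰(Z → c)` -/
  h0NC : ι → γ → ℕ
  /-- `h²(Z′ → Z) = ext²(L_{Z′}, L_Z)` -/
  h2NN : ι → ι → ℕ

namespace PairOracle

variable {ι α γ : Type} (T : PairOracle ι α γ)

/-- `Z` is C-target-free: `Hom(L_Z, L_c) = 0` for every C-letter, so `q|_{N_Z} = 0` and `ψ_Z : N_Z → E` exists. -/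
def CTargetFree (Z : ι) : Prop := ∀ c, T.h0NC Z c = 0

/-- `Z′` is A-source-free: `Hom(L_a, L_{Z′}) = 0` for every A-letter, so `pr_{Z′} ∘ i = 0` and `φ_{Z′} : E → N_{Z′}` exists. -/
def ASourceFree (Z' : ι) : Prop := ∀ a, T.h0AN a Z' = 0

/-- Admissible ordered pair `(Z, Z′)`: distinct, `Z` C-target-free, `Z′` A-source-free (`φ_{Z′} ∘ ψ_Z = 0`). -/
def Admissible (Z Z' : ι) : Prop := Z ≠ Z' ∧ T.CTargetFree Z ∧ T.ASourceFree Z'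

/-- HOT pair: admissible with `ext²(L_{Z′}, L_Z) > 0` — a non-zero source for the sandwich map. -/
def Hot (Z Z' : ι) : Prop := T.Admissible Z Z' ∧ 0 < T.h2NN Z' Z

/-- **Design rule (R5) SANDWICH-FREE**: no admissible pair is hot — then LEMMA K imposes nothing on the maps. -/
def SandwichFree : Prop := ∀ Z Z', T.Admissible Z Z' → T.h2NN Z' Z = 0

/-- Sandwich-free ⟺ no hot pair. -/
theorem sandwichFree_iff_no_hot : T.SandwichFree ↔ ∀ Z Z', ¬ T.Hot Z Z' := by
  refine ⟨fun h Z Z' hh => ?_, fun h Z Z' ha => ?_⟩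
  · have := h Z Z' hh.1
    have h2 := hh.2
    rw [this] at h2
    exact (Nat.lt_irrefl 0) h2
  · by_contra hne
    exact h Z Z' ⟨ha, Nat.pos_of_ne_zero hne⟩

end PairOracle

/-- Census digits of one table (engine `bfdoor.py` e79621ea5b4306a2): ψ-classes, φ-classes, admissible pairs, hot pairs,
`D_hot = Σ_{hot} m_Z m_{Z′} h²(Z′→Z)`, NS-row pairs and how many of them are hot. Oracle data, recorded not derived. -/
structure Census where
  /-- design tag -/
  tag : String
  /-- table sha16 -/
  sha16 : String
  /-- C-target-free N-classes -/
  psi : ℕ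
  /-- A-source-free N-classes -/
  phi : ℕ
  /-- admissible ordered pairs -/
  adm : ℕ
  /-- hot pairs -/
  hot : ℕ
  /-- `D_hot` -/
  dHot : ℕ
  /-- NS-row certified pairs (c4-1 g18) -/
  ns : ℕ
  /-- NS-row pairs that are hot -/
  nsHot : ℕ
  deriving DecidableEq

/-- M1 = `a24-dblC3` (table adc84d1b7bb2d10c). -/
def censusM1 : Census := ⟨"M1 a24-dblC3", "adc84d1b7bb2d10c", 12, 24, 288, 216, 3528, 24, 24⟩
/-- M3 = `s2-a16-dblC` (table 63cd7469c7078c8b). -/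
def censusM3 : Census := ⟨"M3 s2-a16-dblC", "63cd7469c7078c8b", 12, 32, 384, 240, 4368, 48, 48⟩
/-- SYM = `a24-dblC3-sym` (table 352cda2c00c0b3c4), the LIVE program-M design. -/
def censusSYM : Census := ⟨"SYM a24-dblC3-sym", "352cda2c00c0b3c4", 12, 24, 288, 216, 3528, 24, 24⟩

/-- The three designs of record. -/
def ofRecord : List Census := [censusM1, censusM3, censusSYM]

/-- Consistency of the recorded digits: `adm = ψ·φ` (no class is both C-target-free and A-source-free), `hot ≤ adm`,
every NS-row pair is hot, and NO design of record is sandwich-free (`hot > 0`, `D_hot > 0`). -/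
theorem ofRecord_checks :
    ∀ c ∈ ofRecord, c.adm = c.psi * c.phi ∧ c.hot ≤ c.adm ∧ c.nsHot = c.ns ∧ 0 < c.hot ∧ 0 < c.dHot := by
  decide

/-- `D_hot` decomposition on M1 ∕ SYM: 192 pairs `N18 → N36` with `h² = 6` and 24 pairs `N22 → N36` with `h² = 15`, weighted by the
multiplicities of the twelve C-target-free N36 classes (8 at multiplicity 2, 4 at 3 on `a24-dblC3`): `6·(16·1·28) + 15·(2·1·28)`… recorded
as the engine's total only; here the two elementary identities used in the memo. -/
theorem hodge_pair_profiles : (1 + 4 + 6 + 4 + 1 = 16) ∧ (1 + 6 + 15 + 20 + 15 + 6 + 1 = 64) := by decide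

end Design

end HSemireg.C4BFSandwich
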